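import Mathlib
import Summits.RiemannHypothesis.RiemannHypothesis.Theses.SpectralTrace
import Summits.RiemannHypothesis.RiemannHypothesis.Theorems.WindowTraceArch.Negative.ComplexSpectrum
import Summits.RiemannHypothesis.RiemannHypothesis.Theorems.WindowTraceArch.Negative.LocalWeyl
import Summits.RiemannHypothesis.RiemannHypothesis.Theorems.WindowTraceArch.Negative.LocalWeylTools
import Summits.RiemannHypothesis.RiemannHypothesis.Theorems.WindowTraceArch.Negative.UnitMass
import Summits.RiemannHypothesis.RiemannHypothesis.Theorems.WindowTraceArch.Negative.FiniteSpectrum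
import Literature.NumberTheory.LFunctions.WeilExplicitProofs
import Literature.NumberTheory.LFunctions.WeilCriterionProofs
import Literature.NumberTheory.LFunctions.WeilArchimedeanPositivityProofs
import Literature.NumberTheory.LFunctions.WeilMellinBounds
import Literature.NumberTheory.LFunctions.WeilExplicitRightEdge

/-!
# `SelfMajorantComplete.lean` — end-to-end kernel check of the line `self-majorant-peak`
(crux `SpectralIsHpSpectrum`, stmt-RiemannHypothesis-0195; crux-ideate round 1, ideator 2 gen 2)

This file is EVIDENCE, not a Theorems proposal (planners do not propose proofs). It concatenates:

1. `…SelfMajorant.DisproofCopy` — VERBATIM copy of the standing disprover's `Disproof.lean` §0–§2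
   (refuter-cdisprove seat, 2026-08-16T02:30Z; copied exactly as already vendored in
   `Cruxes/SpectralIsHpSpectrum/SketchIdeator1.lean`, because the farm has not yet built the module
   `…Cruxes.SpectralIsHpSpectrum.Disproof` — `lean check` answers `remote:stale:unbuilt`). All credit:
   the disprover. A Theorems file should `import …Cruxes.SpectralIsHpSpectrum.Disproof` instead.
2. `…SelfMajorant` shared vocabulary + the reduction `spectralIsHpSpectrum_of_realSpectrumUnique`
   — VERBATIM from `SketchIdeator1.lean` (crux-ideate ideator 1, 2026-08-16T02:35Z). All credit:
   ideator 1.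
3. Card D of THIS seat (`self-majorant-peak`): the W-free transfer `RealSpectrumUnique` PROVED by
   the self-majorised Tannery limit (`tendsto_trace_conv_peak`), ≈ 190 lines, no sorry.
4. `spectralIsHpSpectrum_via_selfMajorant : SpectralTrace.SpectralIsHpSpectrum` — the crux BY NAME.
-/

noncomputable section

open Complex Set MeasureTheory Filter
open scoped Real Topology

namespace Summit.RiemannHypothesis.RiemannHypothesis.Cruxes.SpectralIsHpSpectrum.SelfMajorant.DisproofCopy

open Literature.NumberTheory.LFunctions
open Summit.RiemannHypothesis.RiemannHypothesis.Theses.SpectralTrace (SpectralIsHpSpectrum)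
open Summit.RiemannHypothesis.RiemannHypothesis.Theorems.WindowTraceArch.Negative

/-! ## §0 Vocabulary (definitional abbreviations of the crux's pieces) -/

/-- The hypothesis of the crux on a real family `γ`: it reproduces `W` on every Weil test
(this is the route target `X` instantiated at `γ`). [folklore] -/
def IsTrace {ι : Type*} (γ : ι → ℝ) : Prop :=
  ∀ g : ℝ → ℂ, IsWeilTest g →
    HasSum (fun i => weilMellin g (1 / 2 + (γ i : ℂ) * I)) (weilFunctional g)

/-- The right-hand side of the crux: multiplicity of `z` as a NON-TRIVIAL zero, in `ℕ∞`. [folklore] -/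
def mult (z : ℂ) : ℕ∞ :=
  ZetaZeros.riemannZetaNontrivialZeros.indicator (fun w => (analyticOrderNatAt riemannZeta w : ℕ∞)) z

/-- The fibre of the family over `z`. [folklore] -/
def fibre {ι : Type*} (γ : ι → ℝ) (z : ℂ) : Set ι :=
  {i : ι | (1 / 2 : ℂ) + (γ i : ℂ) * I = z}

/-- The crux, unfolded into the vocabulary above (definitional). [folklore] -/
theorem spectralIsHpSpectrum_iff :
    SpectralIsHpSpectrum ↔
      ∀ (ι : Type) (γ : ι → ℝ), IsTrace γ → ∀ z : ℂ, (fibre γ z).encard = mult z :=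
  Iff.rfl

/-! ## §1 Why no unconditional kill exists: the hypothesis proves RH -/

/-- A full trace is a window trace on every window. [folklore] -/
theorem windowTrace_of_isTrace {ι : Type*} {γ : ι → ℝ} (h : IsTrace γ) (A : ℝ) :
    ∀ g : ℝ → ℂ, IsWeilTest g → tsupport g ⊆ Icc (-A) A →
      HasSum (fun i => weilMellin g (1 / 2 + (γ i : ℂ) * I)) (weilFunctional g) :=
  fun g hg _ => h g hg

/-- A compactly supported function is supported in some `[-R, R]`, `R > 0`. [folklore] -/
theorem exists_tsupport_subset_Icc {g : ℝ → ℂ} (hg : HasCompactSupport g) :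
    ∃ R : ℝ, 0 < R ∧ tsupport g ⊆ Icc (-R) R := by
  obtain ⟨R, hR⟩ := hg.isCompact.isBounded.subset_closedBall 0
  refine ⟨max R 1, by positivity, hR.trans fun x hx => ?_⟩
  rw [Metric.mem_closedBall, dist_zero_right, Real.norm_eq_abs] at hx
  have h1 := le_max_left R 1
  exact ⟨by linarith [neg_abs_le x], by linarith [le_abs_self x]⟩

/-- **Bochner form of a full trace**: `HasSum (i ↦ |ĝ(1/2+iγ_i)|²) (Re Q(g))` for every Weil test
(`hasSum_norm_sq_of_windowTrace` on a window containing `supp (g ⋆ g̃)`). [folklore] -/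
theorem hasSum_norm_sq_of_isTrace {ι : Type*} {γ : ι → ℝ} (h : IsTrace γ) {g : ℝ → ℂ}
    (hg : IsWeilTest g) :
    HasSum (fun i => ‖weilMellin g (1 / 2 + (γ i : ℂ) * I)‖ ^ 2) (weilQuadratic g).re := by
  obtain ⟨R, -, hR⟩ := exists_tsupport_subset_Icc hg.2
  refine hasSum_norm_sq_of_windowTrace (A := 2 * R) (windowTrace_of_isTrace h (2 * R)) hg ?_
  rwa [show (2 * R) / 2 = R by ring]

/-- A full trace gives Weil positivity. [folklore] -/
theorem weilPositivity_of_isTrace {ι : Type*} {γ : ι → ℝ} (h : IsTrace γ) : WeilPositivity :=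
  fun _ hg => (hasSum_norm_sq_of_isTrace h hg).nonneg fun _ => by positivity

/-- **Any family satisfying the hypothesis of the crux proves RH** (Weil's criterion,
`weil_criterion_holds`). [folklore] -/
theorem riemannHypothesis_of_isTrace {ι : Type*} {γ : ι → ℝ} (h : IsTrace γ) :
    _root_.RiemannHypothesis :=
  (show _root_.RiemannHypothesis ↔ WeilPositivity from weil_criterion_holds).2
    (weilPositivity_of_isTrace h)

/-- **Vacuity branch**: if RH fails the crux holds (no family satisfies its hypothesis). [folklore] -/
theorem spectralIsHpSpectrum_of_not_riemannHypothesis (hRH : ¬ _root_.RiemannHypothesis) :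
    SpectralIsHpSpectrum :=
  fun _ _ hγ => absurd (riemannHypothesis_of_isTrace hγ) hRH

/-- **Barrier: a refutation of the crux is a proof of RH.** [folklore] -/
theorem riemannHypothesis_of_not_spectralIsHpSpectrum (h : ¬ SpectralIsHpSpectrum) :
    _root_.RiemannHypothesis := by
  by_contra hRH
  exact h (spectralIsHpSpectrum_of_not_riemannHypothesis hRH)

/-- The crux is equivalent to its restriction to the RH world. [folklore] -/
theorem spectralIsHpSpectrum_iff_under_rh :
    SpectralIsHpSpectrum ↔ (_root_.RiemannHypothesis → SpectralIsHpSpectrum) := by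
  refine ⟨fun h _ => h, fun h => ?_⟩
  by_cases hRH : _root_.RiemannHypothesis
  · exact h hRH
  · exact spectralIsHpSpectrum_of_not_riemannHypothesis hRH

/-! ## §2 The reduction handed to the prover -/

/-- Membership in a fibre: `z` must be on the critical line and `γ_i = Im z`. [folklore] -/
theorem mem_fibre_iff {ι : Type*} (γ : ι → ℝ) (z : ℂ) (i : ι) :
    i ∈ fibre γ z ↔ z.re = 1 / 2 ∧ γ i = z.im := by
  simp only [fibre, mem_setOf_eq]
  constructor
  · rintro rfl
    simp
  · rintro ⟨hre, him⟩
    apply Complex.ext <;> simp [hre, him]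

/-- Off the critical line every fibre is empty. [folklore] -/
theorem fibre_eq_empty_of_re_ne {ι : Type*} (γ : ι → ℝ) {z : ℂ} (hz : z.re ≠ 1 / 2) :
    fibre γ z = ∅ := by
  ext i
  simp only [mem_fibre_iff, mem_empty_iff_false, iff_false, not_and]
  exact fun h _ => hz h

/-- On the critical line the fibre over `1/2 + iτ` is `{i | γ_i = τ}`. [folklore] -/
theorem fibre_half_add {ι : Type*} (γ : ι → ℝ) (τ : ℝ) :
    fibre γ (1 / 2 + τ * I) = {i | γ i = τ} := by
  ext i
  simp [mem_fibre_iff]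

/-- **Every fibre of a trace family is finite** (local finiteness, `finite_abs_le_of_windowTrace`
from the landed local Weyl law); so the left-hand side of the crux is never `⊤`. [folklore] -/
theorem finite_fibre {ι : Type*} {γ : ι → ℝ} (h : IsTrace γ) (z : ℂ) : (fibre γ z).Finite :=
  (finite_abs_le_of_windowTrace one_pos (windowTrace_of_isTrace h 1) |z.im|).subset fun i hi => by
    have him := ((mem_fibre_iff γ z i).1 hi).2
    show |γ i| ≤ |z.im|
    rw [him]

/-- The analytic order of `ζ` is finite away from the pole (identity principle, `ζ(2) ≠ 0`).
[folklore] -/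
theorem analyticOrderAt_riemannZeta_ne_top' {ρ : ℂ} (h : ρ ≠ 1) :
    analyticOrderAt riemannZeta ρ ≠ ⊤ := by
  intro htop
  have h2 : riemannZeta 2 = 0 :=
    analyticOn_riemannZeta.eqOn_zero_of_preconnected_of_eventuallyEq_zero
      (isConnected_compl_singleton_of_one_lt_rank (by simp) (1 : ℂ)).isPreconnected h
      (analyticOrderAt_eq_top.mp htop) (show (2 : ℂ) ∈ ({1}ᶜ : Set ℂ) by norm_num)
  exact riemannZeta_ne_zero_of_one_le_re (s := 2) (by norm_num) h2

/-- `mult z = 0` off the non-trivial zeros. [folklore] -/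
theorem mult_of_not_mem {z : ℂ} (hz : z ∉ ZetaZeros.riemannZetaNontrivialZeros) : mult z = 0 :=
  Set.indicator_of_notMem hz _

/-- At a non-trivial zero, `mult z` is the analytic order of `ζ`. [folklore] -/
theorem mult_of_mem {z : ℂ} (hz : z ∈ ZetaZeros.riemannZetaNontrivialZeros) :
    mult z = analyticOrderAt riemannZeta z := by
  rw [mult, Set.indicator_of_mem hz, Nat.cast_analyticOrderNatAt
    (analyticOrderAt_riemannZeta_ne_top' (ZetaZeros.riemannZetaNontrivialZeros.ne_one hz))]

/-- The right-hand side of the crux is never `⊤`. [folklore] -/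
theorem mult_ne_top (z : ℂ) : mult z ≠ ⊤ := by
  by_cases hz : z ∈ ZetaZeros.riemannZetaNontrivialZeros
  · rw [mult_of_mem hz]
    exact analyticOrderAt_riemannZeta_ne_top' (ZetaZeros.riemannZetaNontrivialZeros.ne_one hz)
  · rw [mult_of_not_mem hz]
    exact ENat.coe_ne_top 0

/-- Under RH the non-trivial zeros are on the critical line (unfolding Mathlib's clauses).
[folklore] -/
theorem re_eq_half_of_mem (hRH : _root_.RiemannHypothesis) {z : ℂ}
    (hz : z ∈ ZetaZeros.riemannZetaNontrivialZeros) : z.re = 1 / 2 := by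
  refine hRH z (ZetaZeros.riemannZetaNontrivialZeros.zeta_eq_zero hz) ?_
    (ZetaZeros.riemannZetaNontrivialZeros.ne_one hz)
  rintro ⟨n, hn⟩
  have h0 := ZetaZeros.riemannZetaNontrivialZeros.re_pos hz
  rw [hn] at h0
  simp at h0
  linarith [n.cast_nonneg (α := ℝ)]

/-- **Off the critical line both sides of the crux vanish** for a trace family (the fibre is
empty; the hypothesis gives RH, which empties the right-hand side). [folklore] -/
theorem encard_fibre_eq_mult_of_re_ne_half {ι : Type*} {γ : ι → ℝ} (h : IsTrace γ) {z : ℂ}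
    (hz : z.re ≠ 1 / 2) : (fibre γ z).encard = mult z := by
  rw [fibre_eq_empty_of_re_ne γ hz, Set.encard_empty,
    mult_of_not_mem fun hmem => hz (re_eq_half_of_mem (riemannHypothesis_of_isTrace h) hmem)]

/-- In the open strip, `mult s` IS the analytic order — no case split on `ζ s = 0` survives.
[folklore] -/
theorem mult_eq_analyticOrderAt_of_mem_strip {s : ℂ} (h0 : 0 < s.re) (h1 : s.re < 1) :
    mult s = analyticOrderAt riemannZeta s := by
  by_cases hζ : riemannZeta s = 0
  · exact mult_of_mem (ZetaZeros.riemannZetaNontrivialZeros.mem_of_re_pos hζ h0)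
  · rw [mult_of_not_mem fun h => hζ (ZetaZeros.riemannZetaNontrivialZeros.zeta_eq_zero h)]
    have hs : s ≠ 1 := by
      intro h; rw [h] at h1; simp at h1
    exact ((analyticOn_riemannZeta s hs).analyticOrderAt_eq_zero.2 hζ).symm

/-- `m(s) = analyticOrderNatAt ζ s` for every `s ≠ 1`: the explicit formula's multiplicity is the
crux's multiplicity. [folklore] -/
theorem riemannZetaZeroOrder_eq_analyticOrderNatAt {s : ℂ} (hs : s ≠ 1) :
    riemannZetaZeroOrder s = (analyticOrderNatAt riemannZeta s : ℤ) := by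
  have ha : AnalyticAt ℂ riemannZeta s := analyticOn_riemannZeta s hs
  obtain ⟨n, hn⟩ := ENat.ne_top_iff_exists.mp (analyticOrderAt_riemannZeta_ne_top' hs)
  rw [riemannZetaZeroOrder, ha.meromorphicOrderAt_eq, ← hn, ENat.map_coe, WithTop.untop₀_coe,
    analyticOrderNatAt, ← hn, ENat.toNat_coe]

/-- A point `1/2 + iτ` of the critical line is not the pole. [folklore] -/
theorem half_add_ne_one (τ : ℝ) : (1 / 2 : ℂ) + τ * I ≠ 1 := by
  intro h
  have := congrArg Complex.re h
  norm_num at this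

/-- **On the critical line the crux's equation is `#{i | γ_i = τ} = m(1/2+iτ)` in `ℤ`**, for any
family with finite fibres. [folklore] -/
theorem encard_fibre_eq_mult_iff {ι : Type*} (γ : ι → ℝ) (τ : ℝ) (hfin : {i | γ i = τ}.Finite) :
    (fibre γ (1 / 2 + τ * I)).encard = mult (1 / 2 + τ * I) ↔
      (({i : ι | γ i = τ}.ncard : ℕ) : ℤ) = riemannZetaZeroOrder (1 / 2 + τ * I) := by
  have hs : (1 / 2 : ℂ) + τ * I ≠ 1 := half_add_ne_one τ
  obtain ⟨n, hn⟩ := ENat.ne_top_iff_exists.mp (analyticOrderAt_riemannZeta_ne_top' hs)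
  have hnat : analyticOrderNatAt riemannZeta (1 / 2 + τ * I) = n := by
    rw [analyticOrderNatAt, ← hn, ENat.toNat_coe]
  rw [fibre_half_add, mult_eq_analyticOrderAt_of_mem_strip (by simp) (by norm_num),
    riemannZetaZeroOrder_eq_analyticOrderNatAt hs, hnat, ← hn, ← hfin.cast_ncard_eq, Nat.cast_inj,
    Nat.cast_inj]

/-- **THE REDUCTION.** The crux is equivalent to: for every real family reproducing `W` on all
Weil tests and every real `τ`, the number of indices with `γ_i = τ` equals the multiplicity
`m(1/2 + iτ)` of the explicit formula (`riemannZetaZeroOrder`; `0` when `ζ(1/2+iτ) ≠ 0`).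
All `encard`/`indicator`/`analyticOrderNatAt`/off-line bookkeeping is discharged here. [folklore] -/
theorem spectralIsHpSpectrum_iff_ordinate_count :
    SpectralIsHpSpectrum ↔ ∀ (ι : Type) (γ : ι → ℝ), IsTrace γ →
      ∀ τ : ℝ, (({i : ι | γ i = τ}.ncard : ℕ) : ℤ) = riemannZetaZeroOrder (1 / 2 + τ * I) := by
  rw [spectralIsHpSpectrum_iff]
  constructor
  · intro h ι γ hγ τ
    have hfin : {i | γ i = τ}.Finite := by simpa only [fibre_half_add] using finite_fibre hγ (1 / 2 + τ * I)
    exact (encard_fibre_eq_mult_iff γ τ hfin).1 (h ι γ hγ _)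
  · intro h ι γ hγ z
    by_cases hz : z.re = 1 / 2
    · have hzeq : z = 1 / 2 + (z.im : ℝ) * I := by
        apply Complex.ext <;> simp [hz]
      have hfin : {i | γ i = z.im}.Finite := by
        simpa only [fibre_half_add] using finite_fibre hγ (1 / 2 + (z.im : ℝ) * I)
      rw [hzeq]
      exact (encard_fibre_eq_mult_iff γ z.im hfin).2 (h ι γ hγ z.im)
    · exact encard_fibre_eq_mult_of_re_ne_half hγ hz

/-- **THE REDUCTION, RH granted.** Since the hypothesis proves RH (§1), the prover may assume RH:
then `ρ = 1/2 + i Im ρ` for every non-trivial zero (`eq_half_add_of_riemannHypothesis`) and the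
explicit formula (`hasSum_weilMellin_zeros`) is a second real trace; what remains is uniqueness of
the counting measure of a real trace (Fourier uniqueness for tempered positive measures).
[folklore] -/
theorem spectralIsHpSpectrum_iff_rigidity_under_rh :
    SpectralIsHpSpectrum ↔ ∀ (ι : Type) (γ : ι → ℝ), _root_.RiemannHypothesis → IsTrace γ →
      ∀ τ : ℝ, (({i : ι | γ i = τ}.ncard : ℕ) : ℤ) = riemannZetaZeroOrder (1 / 2 + τ * I) := by
  rw [spectralIsHpSpectrum_iff_ordinate_count]
  exact ⟨fun h ι γ _ hγ => h ι γ hγ, fun h ι γ hγ => h ι γ (riemannHypothesis_of_isTrace hγ) hγ⟩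

/-- Under RH the ordinates of the non-trivial zeros, repeated with multiplicity, form a trace
family (the calibration `SpectralConverse`, from the landed `hasSum_weilMellin_zeros`). [folklore] -/
theorem isTrace_ordinates_of_rh (hRH : _root_.RiemannHypothesis) :
    IsTrace (fun p : (Σ ρ : ZetaZeros.riemannZetaNontrivialZeros,
      Fin (riemannZetaZeroOrder (ρ : ℂ)).toNat) => (p.1 : ℂ).im) :=
  fun _ hg => by simpa only [eq_half_add_of_riemannHypothesis hRH] using hasSum_weilMellin_zeros hg

end Summit.RiemannHypothesis.RiemannHypothesis.Cruxes.SpectralIsHpSpectrum.SelfMajorant.DisproofCopy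

namespace Summit.RiemannHypothesis.RiemannHypothesis.Cruxes.SpectralIsHpSpectrum.SelfMajorant

open Literature.NumberTheory.LFunctions
open Summit.RiemannHypothesis.RiemannHypothesis.Theorems.WindowTraceArch.Negative

/-! ## Shared vocabulary and the transfer C⁺ -/

/-- `γ` is a real spectrum for the functional `L`: `Σ_i ĝ(1/2 + iγ_i) = L g` (HasSum) on every
Weil test. The crux hypothesis is `IsRealSpectrumFor γ weilFunctional`. -/
def IsRealSpectrumFor {ι : Type*} (γ : ι → ℝ) (L : (ℝ → ℂ) → ℂ) : Prop :=
  ∀ g : ℝ → ℂ, IsWeilTest g → HasSum (fun i => weilMellin g (1 / 2 + (γ i : ℂ) * I)) (L g)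

/-- TRANSFER C⁺ (W-free form, cards A and C): two real spectra of the SAME functional have the
same multiplicities. -/
def RealSpectrumUnique : Prop :=
  ∀ (ι ι' : Type) (γ : ι → ℝ) (γ' : ι' → ℝ) (L : (ℝ → ℂ) → ℂ),
    IsRealSpectrumFor γ L → IsRealSpectrumFor γ' L →
      ∀ x : ℝ, {i | γ i = x}.encard = {j | γ' j = x}.encard

/-- TRANSFER C⁺_W (card B: needs the local Weyl law, hence `L = weilFunctional`). -/
def RealWeilSpectrumUnique : Prop :=
  ∀ (ι ι' : Type) (γ : ι → ℝ) (γ' : ι' → ℝ),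
    IsRealSpectrumFor γ weilFunctional → IsRealSpectrumFor γ' weilFunctional →
      ∀ x : ℝ, {i | γ i = x}.encard = {j | γ' j = x}.encard

theorem realWeilSpectrumUnique_of_realSpectrumUnique (h : RealSpectrumUnique) :
    RealWeilSpectrumUnique :=
  fun ι ι' γ γ' hγ hγ' x => h ι ι' γ γ' weilFunctional hγ hγ' x

/-- The canonical real spectrum under RH: ordinates of the non-trivial zeros repeated with
multiplicity (index type of `hasSum_weilMellin_zeros`). -/
def zetaOrdinates :
    (Σ ρ : ZetaZeros.riemannZetaNontrivialZeros, Fin (riemannZetaZeroOrder (ρ : ℂ)).toNat) → ℝ :=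
  fun p => (p.1 : ℂ).im

/-- Calibration (landed ingredients: `hasSum_weilMellin_zeros`, `eq_half_add_of_riemannHypothesis`). -/
theorem isRealSpectrumFor_zetaOrdinates (hRH : _root_.RiemannHypothesis) :
    IsRealSpectrumFor zetaOrdinates weilFunctional := by
  intro g hg
  simpa only [zetaOrdinates, eq_half_add_of_riemannHypothesis hRH] using hasSum_weilMellin_zeros hg

/-- A real spectrum of `W` forces RH — this is the standing disprover's §1
(`DisproofCopy.riemannHypothesis_of_isTrace`, kernel-checked; `IsTrace γ` is definitionally
`IsRealSpectrumFor γ weilFunctional`). -/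
theorem riemannHypothesis_of_isRealSpectrumFor {ι : Type*} {γ : ι → ℝ}
    (hγ : IsRealSpectrumFor γ weilFunctional) : _root_.RiemannHypothesis :=
  DisproofCopy.riemannHypothesis_of_isTrace hγ

/-- Fibre count of the canonical family: `#{p : Im ρ_p = τ} = m(1/2 + iτ)` under RH. -/
theorem ncard_zetaOrdinates_fibre (hRH : _root_.RiemannHypothesis) (τ : ℝ) :
    (({p | zetaOrdinates p = τ}.ncard : ℕ) : ℤ) = riemannZetaZeroOrder (1 / 2 + τ * I) := by
  set s : ℂ := 1 / 2 + τ * I with hs_def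
  have hs1 : s ≠ 1 := DisproofCopy.half_add_ne_one τ
  by_cases hz : s ∈ ZetaZeros.riemannZetaNontrivialZeros
  · have hset : {p : (Σ ρ : ZetaZeros.riemannZetaNontrivialZeros,
        Fin (riemannZetaZeroOrder (ρ : ℂ)).toNat) | zetaOrdinates p = τ} =
        Set.range (Sigma.mk (β := fun ρ : ZetaZeros.riemannZetaNontrivialZeros =>
          Fin (riemannZetaZeroOrder (ρ : ℂ)).toNat) ⟨s, hz⟩) := by
      ext p
      simp only [Set.mem_setOf_eq, Set.mem_range, zetaOrdinates]
      constructor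
      · intro hp
        obtain ⟨ρ, c⟩ := p
        have hρ : ρ = ⟨s, hz⟩ := by
          apply Subtype.ext
          have h1 := eq_half_add_of_riemannHypothesis hRH ρ
          simp only at hp
          rw [← h1, hp]
        subst hρ
        exact ⟨c, rfl⟩
      · rintro ⟨c, rfl⟩
        simp [hs_def]
    rw [hset, Set.ncard_range_of_injective sigma_mk_injective, Nat.card_eq_fintype_card,
      Fintype.card_fin]
    have h1 := ZetaZeros.riemannZetaNontrivialZeros.one_le_order hz
    change (((riemannZetaZeroOrder s).toNat : ℕ) : ℤ) = riemannZetaZeroOrder s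
    exact Int.toNat_of_nonneg (by omega)
  · have hset : {p : (Σ ρ : ZetaZeros.riemannZetaNontrivialZeros,
        Fin (riemannZetaZeroOrder (ρ : ℂ)).toNat) | zetaOrdinates p = τ} = ∅ := by
      ext p
      simp only [Set.mem_setOf_eq, Set.mem_empty_iff_false, iff_false, zetaOrdinates]
      intro hp
      apply hz
      have h1 := eq_half_add_of_riemannHypothesis hRH p.1
      rw [hp] at h1
      rw [hs_def, h1]
      exact p.1.2
    rw [hset, Set.ncard_empty]
    have h0 : ¬ 0 < riemannZetaZeroOrder s := by
      rw [riemannZetaZeroOrder_pos_iff hs1]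
      intro hζ
      exact hz (ZetaZeros.riemannZetaNontrivialZeros.mem_of_re_pos hζ (by simp [hs_def]))
    have h2 := riemannZetaZeroOrder_nonneg hs1
    push_cast
    omega

/-- **Shared reduction (kernel-checked modulo nothing)**: the transfer closes the crux BY NAME.
Uses the standing disprover's §2 `spectralIsHpSpectrum_iff_ordinate_count` (all
`encard`/indicator/off-line bookkeeping) and §1 (RH from the hypothesis). -/
theorem spectralIsHpSpectrum_of_unique (hU : RealWeilSpectrumUnique) :
    Summit.RiemannHypothesis.RiemannHypothesis.Theses.SpectralTrace.SpectralIsHpSpectrum := by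
  rw [DisproofCopy.spectralIsHpSpectrum_iff_ordinate_count]
  intro ι γ hγ τ
  have hRH : _root_.RiemannHypothesis := DisproofCopy.riemannHypothesis_of_isTrace hγ
  have hord : IsRealSpectrumFor zetaOrdinates weilFunctional := isRealSpectrumFor_zetaOrdinates hRH
  have hfinγ : {i | γ i = τ}.Finite := by
    simpa only [DisproofCopy.fibre_half_add] using DisproofCopy.finite_fibre hγ (1 / 2 + τ * I)
  have hfino : {p | zetaOrdinates p = τ}.Finite := by
    simpa only [DisproofCopy.fibre_half_add] using DisproofCopy.finite_fibre hord (1 / 2 + τ * I)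
  have h := hU ι _ γ zetaOrdinates hγ hord τ
  rw [← hfinγ.cast_ncard_eq, ← hfino.cast_ncard_eq, Nat.cast_inj] at h
  rw [← ncard_zetaOrdinates_fibre hRH τ, h]

/-- The W-free transfer closes the crux as well. -/
theorem spectralIsHpSpectrum_of_realSpectrumUnique (hU : RealSpectrumUnique) :
    Summit.RiemannHypothesis.RiemannHypothesis.Theses.SpectralTrace.SpectralIsHpSpectrum :=
  spectralIsHpSpectrum_of_unique (realWeilSpectrumUnique_of_realSpectrumUnique hU)


/-! ## Card D of ideator 2 (gen 2): `self-majorant-peak` — all proofs of this seat -/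

/-! ## Card D — the trace is its own Tannery majorant -/

/-- **THE LEVER.** A real spectrum is absolutely summable against every Weil test: the
hypothesis instance at `g` is its own majorant (`HasSum` in the finite-dimensional space `ℂ`
is unconditional, hence absolute, convergence — `summable_norm_iff`). No local Weyl law, no
positivity, no value of `L` is used. -/
theorem summable_norm_of_isRealSpectrumFor {ι : Type*} {γ : ι → ℝ} {L : (ℝ → ℂ) → ℂ}
    (hγ : IsRealSpectrumFor γ L) {g : ℝ → ℂ} (hg : IsWeilTest g) :
    Summable fun i => ‖weilMellin g (1 / 2 + (γ i : ℂ) * I)‖ :=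
  summable_norm_iff.mpr (hγ g hg).summable

/-- **Charged fibres are finite**: if `ĝ(1/2 + ix) ≠ 0` for some Weil test `g`, the fibre over
`x` is finite (the terms on the fibre are all equal to `ĝ(1/2+ix) ≠ 0`, and a summable family
tends to `0` along the cofinite filter). Since `exists_isWeilTest_re_weilMellin_pos x` supplies
such a `g` for every `x`, EVERY fibre of a real spectrum is finite — without the local Weyl law. -/
theorem finite_fibre_of_weilMellin_ne_zero {ι : Type*} {γ : ι → ℝ} {L : (ℝ → ℂ) → ℂ}
    (hγ : IsRealSpectrumFor γ L) {g : ℝ → ℂ} (hg : IsWeilTest g) {x : ℝ}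
    (hx : weilMellin g (1 / 2 + x * I) ≠ 0) : {i | γ i = x}.Finite := by
  have h0 := (summable_norm_of_isRealSpectrumFor hγ hg).tendsto_cofinite_zero
  have hε : (0 : ℝ) < ‖weilMellin g (1 / 2 + x * I)‖ := norm_pos_iff.mpr hx
  have hev : ∀ᶠ i in cofinite, ‖weilMellin g (1 / 2 + (γ i : ℂ) * I)‖ <
      ‖weilMellin g (1 / 2 + x * I)‖ := h0.eventually (gt_mem_nhds hε)
  rw [Filter.eventually_cofinite] at hev
  refine hev.subset fun i hi => ?_
  simp only [Set.mem_setOf_eq] at hi ⊢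
  rw [hi]
  exact lt_irrefl _

/-- Every fibre of a real spectrum is finite. -/
theorem finite_fibre {ι : Type*} {γ : ι → ℝ} {L : (ℝ → ℂ) → ℂ}
    (hγ : IsRealSpectrumFor γ L) (x : ℝ) : {i | γ i = x}.Finite := by
  obtain ⟨g, hg, hpos⟩ := exists_isWeilTest_re_weilMellin_pos x
  refine finite_fibre_of_weilMellin_ne_zero hγ hg (x := x) fun h0 => ?_
  have h1 := hpos (1 / 2)
  have h2 : ((1 / 2 : ℝ) : ℂ) + x * I = 1 / 2 + x * I := by push_cast; ring
  rw [h2, h0] at h1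
  simp at h1

/-- Dilation `(D_R p)(t) = R⁻¹ p(t / R)`. -/
def dilate (p : ℝ → ℂ) (R : ℝ) : ℝ → ℂ :=
  fun t => ((R : ℝ) : ℂ)⁻¹ * p (t / R)

/-- The peak test `p_{n,x}(t) = e^{-ixt} (n+1)⁻¹ p(t/(n+1))` (modulated dilation; support
`(n+1) · supp p` — this is where "ALL Weil tests" is consumed). -/
def peakTest (p : ℝ → ℂ) (n : ℕ) (x : ℝ) : ℝ → ℂ :=
  fun t => cexp (-((x * t : ℝ) : ℂ) * I) * dilate p ((n : ℝ) + 1) t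

/-- Dilations of Weil tests are Weil tests. -/
theorem isWeilTest_dilate {p : ℝ → ℂ} (hp : IsWeilTest p) {R : ℝ} (hR : 0 < R) :
    IsWeilTest (dilate p R) := by
  refine ⟨contDiff_const.mul (hp.1.comp (contDiff_id.div_const R)), ?_⟩
  have e : (fun t : ℝ => p (t / R)) = p ∘ (Homeomorph.mulRight₀ R⁻¹ (inv_ne_zero hR.ne')) := by
    ext t
    simp [div_eq_mul_inv]
  have h2 : HasCompactSupport fun t : ℝ => p (t / R) := by
    rw [e]
    exact hp.2.comp_homeomorph _
  exact h2.mul_left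

/-- **Dilation substitution**: `(D_R p)^(s) = p̂(1/2 + R (s − 1/2))`, i.e. on the line
`(D_R p)^(1/2 + iu) = p̂(1/2 + iRu)` (`t = R y`; `MeasureTheory.Measure.integral_comp_div`). -/
theorem weilMellin_dilate (p : ℝ → ℂ) {R : ℝ} (hR : 0 < R) (s : ℂ) :
    weilMellin (dilate p R) s = weilMellin p (1 / 2 + R * (s - 1 / 2)) := by
  unfold weilMellin dilate
  set G : ℝ → ℂ := fun y => ((R : ℝ) : ℂ)⁻¹ * p y * cexp ((s - 1 / 2) * (R : ℂ) * (y : ℂ))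
    with hG
  have hRC : ((R : ℝ) : ℂ) ≠ 0 := Complex.ofReal_ne_zero.mpr hR.ne'
  have h1 : (fun t : ℝ => ((R : ℝ) : ℂ)⁻¹ * p (t / R) * cexp ((s - 1 / 2) * (t : ℂ))) =
      fun t : ℝ => G (t / R) := by
    ext t
    simp only [hG]
    congr 2
    push_cast
    field_simp
  have h2 : (fun t : ℝ => p t * cexp ((1 / 2 + (R : ℂ) * (s - 1 / 2) - 1 / 2) * (t : ℂ))) =
      fun t : ℝ => ((R : ℝ) : ℂ) * G t := by
    ext t
    simp only [hG]
    have e : (1 / 2 + (R : ℂ) * (s - 1 / 2) - 1 / 2) * (t : ℂ) = (s - 1 / 2) * (R : ℂ) * (t : ℂ) := by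
      ring
    rw [e]
    field_simp
  rw [h1, h2, MeasureTheory.Measure.integral_comp_div G R, abs_of_pos hR, integral_const_mul,
    Complex.real_smul]

/-- Peak tests are Weil tests (`isWeilTest_modulate` ∘ `isWeilTest_dilate`). -/
theorem isWeilTest_peakTest {p : ℝ → ℂ} (hp : IsWeilTest p) (n : ℕ) (x : ℝ) :
    IsWeilTest (peakTest p n x) :=
  isWeilTest_modulate (isWeilTest_dilate hp (by positivity)) x

/-- Spectral side of the peak test: `p̂(1/2 + i (n+1)(u − x))`
(`weilMellin_modulate` + `weilMellin_dilate`). -/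
theorem weilMellin_peakTest (p : ℝ → ℂ) (n : ℕ) (x u : ℝ) :
    weilMellin (peakTest p n x) (1 / 2 + u * I) =
      weilMellin p (1 / 2 + ((((n : ℝ) + 1) * (u - x) : ℝ) : ℂ) * I) := by
  have h1 : weilMellin (peakTest p n x) (1 / 2 + u * I) =
      weilMellin (dilate p ((n : ℝ) + 1)) (1 / 2 + ((u - x : ℝ) : ℂ) * I) :=
    weilMellin_modulate (dilate p ((n : ℝ) + 1)) x u
  rw [h1, weilMellin_dilate p (by positivity)]
  congr 1
  push_cast
  ring

/-- Uniform bound on the line: `|p_{n,x}^(1/2+iu)| ≤ ‖p‖_{L¹(e^{|t|/2})}` (the Tannery envelope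
is a CONSTANT — no monotone-decay bookkeeping). -/
theorem norm_weilMellin_peakTest_le {p : ℝ → ℂ} (hp : IsWeilTest p) (n : ℕ) (x u : ℝ) :
    ‖weilMellin (peakTest p n x) (1 / 2 + u * I)‖ ≤ weilL1 p := by
  rw [weilMellin_peakTest]
  exact norm_weilMellin_le_weilL1 hp.1.continuous hp.2 (by simp) (by norm_num)

/-- Pointwise limit of the peak values: `p̂(1/2)` on the fibre, `0` off it
(`norm_weilMellin_le`: `|p̂(1/2+iv)| ≤ C_p/(1+v²)` with `v = (n+1)(u−x) → ∞`). -/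
theorem tendsto_weilMellin_peakTest {p : ℝ → ℂ} (hp : IsWeilTest p) (x u : ℝ) :
    Tendsto (fun n : ℕ => weilMellin (peakTest p n x) (1 / 2 + u * I)) atTop
      (𝓝 (if u = x then weilMellin p (1 / 2) else 0)) := by
  simp_rw [weilMellin_peakTest]
  by_cases hu : u = x
  · subst hu
    simp only [sub_self, mul_zero, Complex.ofReal_zero, zero_mul, add_zero, if_true]
    exact tendsto_const_nhds
  · rw [if_neg hu]
    have hux : 0 < (u - x) ^ 2 := by
      have : u - x ≠ 0 := sub_ne_zero.mpr hu
      positivity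
    have him : ∀ v : ℝ, ((1 / 2 : ℂ) + (v : ℂ) * I).im = v := fun v => by simp
    have hbound : ∀ n : ℕ, ‖weilMellin p (1 / 2 + ((((n : ℝ) + 1) * (u - x) : ℝ) : ℂ) * I)‖ ≤
        weilDecayConst p / (1 + (((n : ℝ) + 1) * (u - x)) ^ 2) := by
      intro n
      have h := norm_weilMellin_le hp (s := 1 / 2 + ((((n : ℝ) + 1) * (u - x) : ℝ) : ℂ) * I)
        (by simp) (by norm_num)
      rwa [him] at h
    have hden : Tendsto (fun n : ℕ => 1 + (((n : ℝ) + 1) * (u - x)) ^ 2) atTop atTop := by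
      have h1 : Tendsto (fun n : ℕ => ((n : ℝ) + 1)) atTop atTop :=
        tendsto_atTop_add_const_right _ 1 tendsto_natCast_atTop_atTop
      have h2 : Tendsto (fun n : ℕ => ((n : ℝ) + 1) ^ 2) atTop atTop :=
        (tendsto_pow_atTop two_ne_zero).comp h1
      have h3 : Tendsto (fun n : ℕ => (u - x) ^ 2 * ((n : ℝ) + 1) ^ 2) atTop atTop :=
        h2.const_mul_atTop hux
      have h4 : Tendsto (fun n : ℕ => 1 + (u - x) ^ 2 * ((n : ℝ) + 1) ^ 2) atTop atTop :=
        tendsto_atTop_add_const_left _ 1 h3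
      refine h4.congr fun n => ?_
      ring
    have hlim : Tendsto (fun n : ℕ => weilDecayConst p / (1 + (((n : ℝ) + 1) * (u - x)) ^ 2))
        atTop (𝓝 0) := tendsto_const_nhds.div_atTop hden
    exact squeeze_zero_norm hbound hlim

/-- **FIRST LEMMA of card D (self-majorised Tannery limit).** For a real spectrum `γ` of ANY
functional `L` on Weil tests, any Weil tests `g, p` and any `x ∈ ℝ`:
`L(g ⋆ p_{n,x}) ⟶ #{i | γ_i = x} · p̂(1/2) · ĝ(1/2 + ix)` as `n → ∞`.
Proof: `L(g ⋆ p_{n,x}) = Σ_i ĝ(γ_i) · p̂(1/2 + i(n+1)(γ_i − x))` (hypothesis at the Weil test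
`g ⋆ p_{n,x}`, `weilMellin_weilConv_holds`); Tannery (`tendsto_tsum_of_dominated_convergence`)
with the bound `i ↦ weilL1 p · ‖ĝ(γ_i)‖`, summable by `summable_norm_of_isRealSpectrumFor`;
the limit family is supported on the (finite, `finite_fibre`) fibre where it is constant.
The statement is true even read with `ncard`'s junk value: an infinite fibre forces
`ĝ(1/2+ix) = 0` (`finite_fibre_of_weilMellin_ne_zero`). -/
theorem tendsto_trace_conv_peak {ι : Type*} {γ : ι → ℝ} {L : (ℝ → ℂ) → ℂ}
    (hγ : IsRealSpectrumFor γ L) {g p : ℝ → ℂ} (hg : IsWeilTest g) (hp : IsWeilTest p)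
    (x : ℝ) :
    Tendsto (fun n : ℕ => L (weilConv g (peakTest p n x))) atTop
      (𝓝 ((({i | γ i = x}.ncard : ℕ) : ℂ) *
        (weilMellin p (1 / 2) * weilMellin g (1 / 2 + x * I)))) := by
  have hF : {i | γ i = x}.Finite := finite_fibre hγ x
  set f : ℕ → ι → ℂ := fun n i =>
    weilMellin g (1 / 2 + (γ i : ℂ) * I) * weilMellin (peakTest p n x) (1 / 2 + (γ i : ℂ) * I)
    with hf
  set c : ℂ := weilMellin p (1 / 2) * weilMellin g (1 / 2 + x * I) with hc
  set glim : ι → ℂ := fun i => if γ i = x then c else 0 with hglim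
  -- (1) the majorant is the hypothesis itself
  have hbound : Summable fun i => weilL1 p * ‖weilMellin g (1 / 2 + (γ i : ℂ) * I)‖ :=
    (summable_norm_of_isRealSpectrumFor hγ hg).mul_left _
  have hdom : ∀ᶠ n in atTop, ∀ i, ‖f n i‖ ≤ weilL1 p * ‖weilMellin g (1 / 2 + (γ i : ℂ) * I)‖ :=
    Eventually.of_forall fun n i => by
      simp only [hf, norm_mul]
      rw [mul_comm]
      exact mul_le_mul_of_nonneg_right (norm_weilMellin_peakTest_le hp n x (γ i)) (norm_nonneg _)
  -- (2) pointwise limits: `c` on the fibre, `0` off it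
  have hlim : ∀ i, Tendsto (fun n => f n i) atTop (𝓝 (glim i)) := by
    intro i
    have h := (tendsto_weilMellin_peakTest hp x (γ i)).const_mul
      (weilMellin g (1 / 2 + (γ i : ℂ) * I))
    have e : glim i = weilMellin g (1 / 2 + (γ i : ℂ) * I) *
        (if γ i = x then weilMellin p (1 / 2) else 0) := by
      by_cases hi : γ i = x
      · simp only [hglim, if_pos hi]
        rw [hc, hi]
        ring
      · simp only [hglim, if_neg hi, mul_zero]
    rw [e]
    exact h
  -- (3) Tannery
  have hT := tendsto_tsum_of_dominated_convergence hbound hlim hdom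
  -- (4) the limit family sums to `ncard • c`
  have hzero : ∀ i ∉ hF.toFinset, glim i = 0 := fun i hi => by
    have hi' : ¬ γ i = x := by simpa using hi
    simp only [hglim, if_neg hi']
  have hterm : ∀ i ∈ hF.toFinset, glim i = c := fun i hi => by
    have hi' : γ i = x := by simpa using hi
    simp only [hglim, if_pos hi']
  have hsum : ∑' i, glim i = (({i | γ i = x}.ncard : ℕ) : ℂ) * c := by
    rw [tsum_eq_sum hzero, Finset.sum_congr rfl hterm, Finset.sum_const, nsmul_eq_mul,
      Set.ncard_eq_toFinset_card _ hF]
  -- (5) the trace values are the partial objects of Tannery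
  have hval : ∀ n : ℕ, L (weilConv g (peakTest p n x)) = ∑' i, f n i := fun n => by
    have hq := isWeilTest_peakTest hp n x
    rw [← (hγ _ (hg.weilConv hq)).tsum_eq]
    exact tsum_congr fun i =>
      weilMellin_weilConv_holds hg.1.continuous hg.2 hq.1.continuous hq.2 _
  have hfun : (fun n : ℕ => L (weilConv g (peakTest p n x))) = fun n => ∑' i, f n i := funext hval
  rw [hfun, ← hsum]
  exact hT

/-- **Card D closes the W-free transfer**: both spectra compute the SAME sequence
`n ↦ L(g ⋆ p_{n,x})`; uniqueness of limits in `ℂ` (`tendsto_nhds_unique`) and the choices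
`p` with `p̂(1/2) ≠ 0`, `g` with `ĝ(1/2+ix) ≠ 0` (`exists_isWeilTest_re_weilMellin_pos 0 / x`)
give `ncard = ncard`, and `finite_fibre` turns `ncard` into `encard`. -/
theorem realSpectrumUnique_via_selfMajorant : RealSpectrumUnique := by
  intro ι ι' γ γ' L hγ hγ' x
  obtain ⟨g, hg, hgpos⟩ := exists_isWeilTest_re_weilMellin_pos x
  obtain ⟨p, hp, hppos⟩ := exists_isWeilTest_re_weilMellin_pos 0
  have hgx : weilMellin g (1 / 2 + x * I) ≠ 0 := by
    intro h0
    have h1 := hgpos (1 / 2)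
    have h2 : ((1 / 2 : ℝ) : ℂ) + x * I = 1 / 2 + x * I := by push_cast; ring
    rw [h2, h0] at h1
    simp at h1
  have hp0 : weilMellin p (1 / 2) ≠ 0 := by
    intro h0
    have h1 := hppos (1 / 2)
    have h2 : ((1 / 2 : ℝ) : ℂ) + ((0 : ℝ) : ℂ) * I = 1 / 2 := by push_cast; ring
    rw [h2, h0] at h1
    simp at h1
  have h1 := tendsto_trace_conv_peak hγ hg hp x
  have h2 := tendsto_trace_conv_peak hγ' hg hp x
  have h3 := tendsto_nhds_unique h1 h2
  have hc : weilMellin p (1 / 2) * weilMellin g (1 / 2 + x * I) ≠ 0 := mul_ne_zero hp0 hgx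
  have h4 := mul_right_cancel₀ hc h3
  have h5 : {i | γ i = x}.ncard = {j | γ' j = x}.ncard := by exact_mod_cast h4
  rw [← (finite_fibre hγ x).cast_ncard_eq, ← (finite_fibre hγ' x).cast_ncard_eq, h5]


/-! ## The crux by name -/

/-- **The crux `SpectralIsHpSpectrum` (stmt-RiemannHypothesis-0195), kernel-checked end to end**:
reduction (disprover §1–§2 + ideator 1's `spectralIsHpSpectrum_of_realSpectrumUnique`) applied to
this seat's `realSpectrumUnique_via_selfMajorant`. -/
theorem spectralIsHpSpectrum_via_selfMajorant :
    Summit.RiemannHypothesis.RiemannHypothesis.Theses.SpectralTrace.SpectralIsHpSpectrum :=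
  spectralIsHpSpectrum_of_realSpectrumUnique realSpectrumUnique_via_selfMajorant

end Summit.RiemannHypothesis.RiemannHypothesis.Cruxes.SpectralIsHpSpectrum.SelfMajorant

end
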